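import Mathlib.Topology.Instances.ZMod
import Literature.AnabelianGeometry.AbsoluteAnabelian.AbsCuspFacts
import HarnessLib

/-!
# [AbsCusp] Def. 1.1 (ii), Prop. 1.6 (iii), Thm. 1.1 (iii), Thm. 2.1 (i): the universal closures
# of the typed PREDICATES are refuted (schema rows); degenerate consistency instances

S. Mochizuki, *Absolute anabelian cuspidalizations of proper hyperbolic curves*, J. Math. Kyoto
Univ. 47 (2007) 451–539 [cite: MochizukiAbsCusp2007, Def 1.1 (ii) p.10]; locators are pages of the
held copy (`paper:doi-10-1215-kjm-1250281022`), as in `AbsCuspFacts.lean` (whose declarations this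
PROOF-ONLY companion imports and never restates).

Cell abc-iut, block F (FACT-PROVING WAVE, D-0078), seat abc-iut-f-055, tranche 55 of
`plan/F-TRANCHES.tsv` = the four FROZEN FACT-LIST rows F-0049 `AbsCusp.OuterRel`, F-0050
`AbsCusp.Prop_1_6_iii`, F-0051 `AbsCusp.Thm_1_1_iii`, F-0052 `AbsCusp.Thm_2_1_i`.  All four are
`def … : Prop` PREDICATES with explicit parameters (kernel_closedness = parametrised): they TYPE the
printed items as properties of group data, to be consumed AT INSTANCES ("for the data a curve model
assigns", `CuspidalizationFactsModel.lean`).  Header rule R1 of the F wave (abc-iut-plan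
2026-08-26T05:41:23Z): for a parametrised row decide the universal closure; if it is FALSE, file
`not_forall_<decl>` and name the consumed instance forms.  This file does exactly that:

* `not_forall_outerRel` (F-0049): `OuterRel H₁ f g` is the RELATION "`f`, `g` define the same
  `H₁`-outer homomorphism" (Def. 1.1 (ii)); it is vocabulary (an equivalence relation,
  `AbsCusp.outerRel_equivalence`), not an assertion, and its closure `∀ …, OuterRel H₁ f g` fails
  already for `H = H' = ℤ/2`, `f = 1`, `g = id`.  No cone file consumes an instance.
* `not_forall_prop_1_6_iii` (F-0050): fails for the identity `Π ⥲ Π` of a nontrivial extension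
  with the (junk) "inertia group" `I = Π` (clause `I_x ≤ N = Ker`).  Consumed instance form in the
  tree: `AbsCusp.Prop_1_6_iii_model M` (FACT-LIST F-0045) = Prop. 1.6 (iii) for the data of a
  `CurveModel` — the printed theorem itself (structure of the maximal cuspidally central quotient
  of `Δ_{U_S} ↠ Δ_X`), an interface hypothesis the tree cannot discharge (no étale `π₁`).
* `not_forall_thm_1_1_iii` (F-0051): fails for equal data with `diagX = ⊥`, `diagY = ⊤`.  No (M)-form
  is typed in the tree (`CuspidalizationFactsModel.lean`, module doc: "Not here: … Thm. 1.1 (iii)").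
* `not_forall_thm_2_1_i` (F-0052): fails for `Π_{U_S} = 1 ↠ 1` versus `Π_{V_T} = ℤ/2 ↠ 1` (the
  maximal cuspidally abelian quotients `1` and `ℤ/2` are not isomorphic).  Consumed instance forms:
  `AbsCusp.Thm_2_1_i_model` (F-0046, already a schema row) / `Thm_2_1_i_model_sep` and the proved
  composition `AbsCusp.thm_2_1_i_of_prop_2_2_ii` (`AbsCuspSeparated.lean`), all relative to a
  `CurveModel` and conditional on the printed theorems.

and records two DEGENERATE CONSISTENCY instances (the typed predicates are satisfiable in the
cusp-free / identity situation — they are not refutable outright): `prop_1_6_iii_id_of_isEmpty`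
(`S = ∅`, `U_S = X`) and `thm_2_1_i_refl` (`Y = X`, `α = id`).

HONEST FRAMING: a schema refutation says only that the PREDICATE is not a tautology — exactly as
intended by its typer; it takes no side on [AbsCusp] (a refereed, undisputed paper) nor on
[IUTchIII] Cor. 3.12; typed ≠ proved; the instance forms at geometric data remain named
hypotheses of the cone.
-/

noncomputable section

open CategoryTheory
open scoped Classical Pointwise

namespace Literature.AnabelianGeometry.AbsoluteAnabelian

namespace AbsCusp

universe u

/-! ### Two toy groups: `ℤ/1` and `ℤ/2` (finite, discrete, hence profinite) -/

/-- `ℤ/1` has one element. [cite: MochizukiAbsCusp2007, §1 p.6] -/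
theorem subsingleton_zmod_one : Subsingleton (Multiplicative (ZMod 1)) :=
  inferInstanceAs (Subsingleton (Multiplicative (Fin 1)))

/-- The generator of `ℤ/2` is not the identity. [cite: MochizukiAbsCusp2007, §1 p.6] -/
theorem ofAdd_one_ne_one : (Multiplicative.ofAdd (1 : ZMod 2)) ≠ 1 := by decide

/-! ### Two group-theoretic lemmas on the maximal cuspidally abelian quotient `Π_U/[I, I]⁻` -/

/-- In a Hausdorff topological group the trivial subgroup is its own closure.
[cite: MochizukiAbsCusp2007, Def 1.1 (i) p.10] -/
theorem topologicalClosure_bot {G : Type*} [Group G] [TopologicalSpace G] [IsTopologicalGroup G]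
    [T1Space G] : (⊥ : Subgroup G).topologicalClosure = ⊥ :=
  le_antisymm (Subgroup.topologicalClosure_minimal _ le_rfl (by simp)) bot_le

/-- For cuspidalization data `Π_U ↠ Π` with `Π_U` COMMUTATIVE the modulus `[I, I]⁻` is trivial, so a
nontrivial element of `Π_U` has nontrivial image in `Π^{c-ab}_U = Π_U/[I, I]⁻`.
[cite: MochizukiAbsCusp2007, Thm 1.1 (iii) p.27] -/
theorem CuspidalizationData.mk_ne_one_of_comm {P : Type u} [Group P] [TopologicalSpace P]
    (D : CuspidalizationData P) (hcomm : ∀ a b : D.grp, a * b = b * a) {g : D.grp} (hg : g ≠ 1) :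
    (QuotientGroup.mk g : D.MaxCuspAbelian) ≠ 1 := by
  have hmod : D.cuspidallyAbelianModulus = ⊥ := by
    have hc : ⁅D.cuspidal, D.cuspidal⁆ = ⊥ := by
      rw [Subgroup.commutator_eq_bot_iff_le_centralizer]
      intro x _
      rw [Subgroup.mem_centralizer_iff]
      intro y _
      exact hcomm y x
    change (⁅D.cuspidal, D.cuspidal⁆).topologicalClosure = ⊥
    rw [hc]
    exact topologicalClosure_bot
  intro h
  rw [QuotientGroup.eq_one_iff, hmod, Subgroup.mem_bot] at h
  exact hg h

/-- For cuspidalization data with `Π_U` TRIVIAL, `Π^{c-ab}_U` is trivial.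
[cite: MochizukiAbsCusp2007, Thm 1.1 (iii) p.27] -/
theorem CuspidalizationData.eq_one_of_subsingleton {P : Type u} [Group P] [TopologicalSpace P]
    (D : CuspidalizationData P) (hD : ∀ a : D.grp, a = 1) (z : D.MaxCuspAbelian) : z = 1 := by
  induction z using QuotientGroup.induction_on with
  | H a => rw [hD a]; rfl

/-! ### F-0049: Def. 1.1 (ii) `OuterRel` is a relation, not a tautology -/

/-- **F-0049 (schema refutation).**  The universal closure of `AbsCusp.OuterRel` — "any two
homomorphisms `H' → H` differ by an `H₁`-inner automorphism" — is false: for `H = H' = ℤ/2`,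
`H₁ = H`, the trivial homomorphism and the identity are not conjugate.  (Def. 1.1 (ii) p. 10
defines `H₁`-outer homomorphisms as the CLASSES of this relation: `AbsCusp.outerRel_equivalence`;
no cone file consumes an instance of `OuterRel`.) [cite: MochizukiAbsCusp2007, Def 1.1 (ii) p.10] -/
theorem not_forall_outerRel :
    ¬ ∀ (H H' : Type) [Group H] [Group H'] (H₁ : Subgroup H) (f g : H' →* H), OuterRel H₁ f g := by
  intro h
  obtain ⟨c, -, hc⟩ :=
    h (Multiplicative (ZMod 2)) (Multiplicative (ZMod 2)) ⊤ 1 (MonoidHom.id (Multiplicative (ZMod 2)))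
  have h1 := hc (Multiplicative.ofAdd 1)
  rw [MonoidHom.id_apply, MonoidHom.one_apply, mul_one, mul_inv_cancel] at h1
  exact ofAdd_one_ne_one h1

/-! ### F-0050: Prop. 1.6 (iii) as typed is a predicate on `(q, I)`, not a tautology -/

/-- **F-0050 (schema refutation).**  The universal closure of `AbsCusp.Prop_1_6_iii q I` over all
homomorphisms of extensions `q` and all families `I` is false: for the identity of the toy
extension `Π = ℤ/2 ↠ G = 1` and the junk one-member family `I _ = Π`, the clause
"`I_x ≤ N = Ker(Δ_{U_S} ↠ Δ_X)`" fails (`N = 1`).  The instance the cone consumes is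
`AbsCusp.Prop_1_6_iii_model M` (FACT-LIST F-0045: `q = M.res h`, `I` = the cuspidal inertia groups
of `U_S`, for a PROPER curve over an MLF with rational cusps) — i.e. the printed Prop. 1.6 (iii)
itself, a named hypothesis on the interface `CurveModel` (no étale `π₁` in the tree).
[cite: MochizukiAbsCusp2007, Prop 1.6 (iii) p.15] -/
theorem not_forall_prop_1_6_iii :
    ¬ ∀ (E F : FundamentalExtension.{0}) (q : E ⟶ F) (S : Type) (I : S → Subgroup E.arith),
        Prop_1_6_iii q I := by
  intro h
  -- the toy extension `1 → ℤ/2 → ℤ/2 → 1 → 1`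
  let E : FundamentalExtension.{0} :=
    { arith := ProfiniteGrp.of (Multiplicative (ZMod 2))
      gal := ProfiniteGrp.of (Multiplicative (ZMod 1))
      aug := 1
      aug_surjective := fun _ => ⟨1, @Subsingleton.elim _ subsingleton_zmod_one _ _⟩ }
  obtain ⟨-, hle, -, -⟩ := h E E (𝟙 E) PUnit fun _ => ⊤
  have hmem : (Multiplicative.ofAdd (1 : ZMod 2)) ∈
      (FundamentalExtension.Hom.arith (𝟙 E)).toMonoidHom.ker ⊓ E.geom :=
    hle PUnit.unit (Subgroup.mem_top _)
  have hker := (Subgroup.mem_inf.mp hmem).1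
  rw [MonoidHom.mem_ker] at hker
  exact ofAdd_one_ne_one hker

/-- **F-0050, degenerate consistency instance** (`S = ∅`, `U_S = X`, `q = id`): with no cusps the
typed predicate holds — `N = [N, Δ]⁻ = 1` and all clauses are trivial.  (Consistency of the typing
only; the geometric instances remain named hypotheses.) [cite: MochizukiAbsCusp2007, Prop 1.6 (iii) p.15] -/
theorem prop_1_6_iii_id_of_isEmpty (E : FundamentalExtension.{u}) {S : Type u} [IsEmpty S]
    (I : S → Subgroup E.arith) : Prop_1_6_iii (𝟙 E) I := by
  have hN : (FundamentalExtension.Hom.arith (𝟙 E)).toMonoidHom.ker ⊓ E.geom = ⊥ := by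
    rw [eq_bot_iff]
    intro x hx
    exact (Subgroup.mem_inf.mp hx).1
  refine ⟨Function.surjective_id, fun x => isEmptyElim x, ?_, fun x => isEmptyElim x⟩
  rw [hN, Subgroup.commutator_bot_left, topologicalClosure_bot, iSup_of_empty, bot_sup_eq]

/-! ### F-0051: Thm. 1.1 (iii) as typed is a predicate on `(DX, DY, diagX, diagY)` -/

/-- **F-0051 (schema refutation).**  The universal closure of `AbsCusp.Thm_1_1_iii DX DY diagX diagY`
is false: over the all-trivial extension (`Π_X = G = 1`, so `Π_{X×X} = 1`) take `DX = DY` the junk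
datum `Π_{U_{X×X}} := ℤ/2 ↠ 1` and `diagX = ⊥`, `diagY = ⊤`; for `α = αG = id` every `β` carries
`⊥` to `⊥ ≠ ⊤` (`Π^{c-ab} = ℤ/2` is nontrivial).  No (M)-form of Thm. 1.1 (iii) is typed in the tree
(`CuspidalizationFactsModel.lean`, module doc: the cuspidalization groups `Π_{U_{X×X}}` are beyond
`CurveModel`), so no cone file consumes an instance. [cite: MochizukiAbsCusp2007, Thm 1.1 (iii) p.27] -/
theorem not_forall_thm_1_1_iii :
    ¬ ∀ (E F : FundamentalExtension.{0}) (DX : CuspidalizationData (squareGroup E))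
        (DY : CuspidalizationData (squareGroup F)) (diagX : Subgroup DX.MaxCuspAbelian)
        (diagY : Subgroup DY.MaxCuspAbelian), Thm_1_1_iii DX DY diagX diagY := by
  intro h
  -- the all-trivial extension `1 → 1 → 1 → 1 → 1`
  let E : FundamentalExtension.{0} :=
    { arith := ProfiniteGrp.of (Multiplicative (ZMod 1))
      gal := ProfiniteGrp.of (Multiplicative (ZMod 1))
      aug := ContinuousMonoidHom.id _
      aug_surjective := Function.surjective_id }
  have htriv : ∀ p : squareGroup E, p = 1 := fun p =>
    Subtype.ext (Prod.ext (@Subsingleton.elim _ subsingleton_zmod_one _ _)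
      (@Subsingleton.elim _ subsingleton_zmod_one _ _))
  -- the junk cuspidalization datum `ℤ/2 ↠ Π_{X×X} = 1`
  let D : CuspidalizationData (squareGroup E) :=
    { grp := ProfiniteGrp.of (Multiplicative (ZMod 2))
      proj := 1
      proj_surjective := fun p => ⟨1, by rw [htriv p, map_one]⟩ }
  obtain ⟨β, -, hdiag⟩ :=
    h E E D D ⊥ ⊤ (ContinuousMulEquiv.refl _) (ContinuousMulEquiv.refl _) (fun _ => rfl)
  rw [Subgroup.map_bot] at hdiag
  have hne : (QuotientGroup.mk (Multiplicative.ofAdd (1 : ZMod 2)) : D.MaxCuspAbelian) ≠ 1 :=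
    D.mk_ne_one_of_comm (fun a b : Multiplicative (ZMod 2) => mul_comm a b) ofAdd_one_ne_one
  exact hne (Subgroup.mem_bot.mp (hdiag ▸ Subgroup.mem_top _))

/-! ### F-0052: Thm. 2.1 (i) as typed is a predicate on `(DS, DT, α)` -/

/-- **F-0052 (schema refutation).**  The universal closure of `AbsCusp.Thm_2_1_i DS DT α` is false:
over the all-trivial extension (`Π_X = Π_Y = 1`, `α = id`) take `Π_{U_S} := 1` and the junk datum
`Π_{V_T} := ℤ/2`; their maximal cuspidally abelian quotients `1` and `ℤ/2` admit no isomorphism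
`β`.  Consumed instance forms in the tree: `AbsCusp.Thm_2_1_i_model` (FACT-LIST F-0046, itself a
schema row over its `IsSeparated` parameter), `AbsCusp.Thm_2_1_i_model_sep`, and the proved
composition `AbsCusp.thm_2_1_i_of_prop_2_2_ii` (`AbsCuspSeparated.lean`) — all relative to a
`CurveModel` and conditional on the printed Thm. 2.1 (i) / Prop. 2.2 (ii), named hypotheses the
tree cannot discharge (no étale `π₁`). [cite: MochizukiAbsCusp2007, Thm 2.1 (i) p.42] -/
theorem not_forall_thm_2_1_i :
    ¬ ∀ (E F : FundamentalExtension.{0}) (DS : CuspidalizationData E.arith)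
        (DT : CuspidalizationData F.arith) (α : E.arith ≃ₜ* F.arith), Thm_2_1_i DS DT α := by
  intro h
  -- the all-trivial extension `1 → 1 → 1 → 1 → 1`
  let E : FundamentalExtension.{0} :=
    { arith := ProfiniteGrp.of (Multiplicative (ZMod 1))
      gal := ProfiniteGrp.of (Multiplicative (ZMod 1))
      aug := ContinuousMonoidHom.id _
      aug_surjective := Function.surjective_id }
  -- `Π_{U_S} := 1 ↠ Π_X = 1` and the junk datum `Π_{V_T} := ℤ/2 ↠ Π_Y = 1`
  let DS : CuspidalizationData E.arith :=
    { grp := ProfiniteGrp.of (Multiplicative (ZMod 1))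
      proj := ContinuousMonoidHom.id _
      proj_surjective := Function.surjective_id }
  let DT : CuspidalizationData E.arith :=
    { grp := ProfiniteGrp.of (Multiplicative (ZMod 2))
      proj := 1
      proj_surjective := fun _ => ⟨1, @Subsingleton.elim _ subsingleton_zmod_one _ _⟩ }
  obtain ⟨β, -⟩ := h E E DS DT (ContinuousMulEquiv.refl _)
  have hne : (QuotientGroup.mk (Multiplicative.ofAdd (1 : ZMod 2)) : DT.MaxCuspAbelian) ≠ 1 :=
    DT.mk_ne_one_of_comm (fun a b : Multiplicative (ZMod 2) => mul_comm a b) ofAdd_one_ne_one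
  have htriv : ∀ z : DS.MaxCuspAbelian, z = 1 :=
    DS.eq_one_of_subsingleton fun a : Multiplicative (ZMod 1) =>
      @Subsingleton.elim _ subsingleton_zmod_one a 1
  apply hne
  have h1 : β.symm (QuotientGroup.mk (Multiplicative.ofAdd (1 : ZMod 2))) = β.symm 1 := by
    rw [htriv (β.symm _), htriv (β.symm 1)]
  exact β.symm.injective h1

/-- **F-0052, degenerate consistency instance** (`Y = X`, `V_T = U_S`, `α = id`): the identity of
`Π^{c-ab}_{U_S}` lies over the identity of `Π_X`.  (Consistency of the typing only.)
[cite: MochizukiAbsCusp2007, Thm 2.1 (i) p.42] -/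
theorem thm_2_1_i_refl {E : FundamentalExtension.{u}} (D : CuspidalizationData E.arith) :
    Thm_2_1_i D D (ContinuousMulEquiv.refl _) :=
  ⟨MulEquiv.refl _, fun _ => rfl⟩

end AbsCusp

end Literature.AnabelianGeometry.AbsoluteAnabelian

end
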